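import Literature.Geometry.Lorentzian.KerrSchild
import HarnessLib

/-!
# Crux `GenericCensorshipCollarMargin` (stmt-FinalStateConjecture-10809), line `deficit-ratchet`:
# the Kerr-family spin-ratio lock (pure real algebra, the "ratchet" once `J` is eliminated)

Route `BartnikGapSettling`; helper (`--supports stmt-FinalStateConjecture-10809`) landing the proved
kernel `spin_ratio_lock` of the line skeleton `Cruxes/GenericCensorshipCollarMargin/Lines/deficit_ratchet.lean`
(§2), which its composition `windowedMarginClause_of_stubs` consumes verbatim. On the Kerr family the
horizon area is `A = 8π M r₊(M, a) = 8π M² (1 + √(1 − (a/M)²))`; if an earlier quiet epoch of a hole has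
label `(M₀, a₀)` with margin `|a₀| ≤ (1 − θ) M₀`, a later one has label `(M₁, a₁)` with relative mass gain
`M₁ ≤ (1 + θ/16) M₀`, and the areas compare as `A₀ − πθM₀² ≤ A₁ + πθM₁²` (area rigidity with accuracy
`η = πθ` at both epochs and the area theorem in between), then `|a₁| ≤ (1 − θ²/32) M₁`: bounded feeding
plus non-decreasing area lock the spin ratio away from `1`. The first law `dM = (κ/8π) dA + Ω_H dJ`
says the same infinitesimally (`dA = 0 ⇒` extremality is approached only by gaining mass); here it is
the finite, sign-careful version the line needs, with explicit constants.

References: Bardeen–Carter–Hawking, CMP 31 (1973) 161 (first law); Chruściel–Delay–Galloway–Howard,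
AHP 2 (2001) 109, Thm 1.1 (area theorem); the inequality itself is elementary.
-/

noncomputable section

-- D-0017: single-problem summit, `Summit.<S>.<S>.…` by design (cf. lakefile `weak.linter.dupNamespace`).
set_option linter.dupNamespace false

namespace Summit.FinalStateConjecture.FinalStateConjecture.Theorems

open Literature.Geometry.Lorentzian Real

/-- **Spin-ratio lock on the Kerr family** (line `deficit-ratchet`, crux stmt-FinalStateConjecture-10809).
If `0 < θ ≤ 1`, `M₀, M₁ > 0`, `|a₀| ≤ (1 − θ) M₀`, `|a₁| ≤ M₁`, `M₁ ≤ (1 + θ/16) M₀` and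
`8π M₀ r₊(M₀,a₀) − πθ M₀² ≤ 8π M₁ r₊(M₁,a₁) + πθ M₁²` (`Kerr.rPlus M a = M + √(M² − a²)`), then
`|a₁| ≤ (1 − θ²/32) M₁`. Proof: the earlier root is `≥ θM₀`, so the left side is
`≥ (8π + 7πθ) M₀² ≥ (8π + 3πθ) M₁²` by the feeding bound, forcing `√(M₁² − a₁²) ≥ θM₁/4`. [folklore] -/
theorem GenericCensorshipCollarMargin.spin_ratio_lock {θ M₀ a₀ M₁ a₁ : ℝ} (hθ : 0 < θ) (hθ1 : θ ≤ 1)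
    (hM₀ : 0 < M₀) (hM₁ : 0 < M₁) (ha₀ : |a₀| ≤ (1 - θ) * M₀) (ha₁ : |a₁| ≤ M₁)
    (hγ : M₁ ≤ (1 + θ / 16) * M₀)
    (h : 8 * π * M₀ * Kerr.rPlus M₀ a₀ - π * θ * M₀ ^ 2 ≤
      8 * π * M₁ * Kerr.rPlus M₁ a₁ + π * θ * M₁ ^ 2) :
    |a₁| ≤ (1 - θ ^ 2 / 32) * M₁ := by
  unfold Kerr.rPlus at h
  have hπ : 0 < π := Real.pi_pos
  -- the earlier square root is at least `θ M₀`
  have e0 : a₀ ^ 2 ≤ ((1 - θ) * M₀) ^ 2 :=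
    sq_le_sq' (abs_le.1 ha₀).1 (abs_le.1 ha₀).2
  have e1 : (θ * M₀) ^ 2 ≤ M₀ ^ 2 - a₀ ^ 2 := by nlinarith [e0, hθ, hθ1, hM₀]
  have hs₀ : θ * M₀ ≤ √(M₀ ^ 2 - a₀ ^ 2) := by
    calc θ * M₀ = √((θ * M₀) ^ 2) := (Real.sqrt_sq (by positivity)).symm
      _ ≤ √(M₀ ^ 2 - a₀ ^ 2) := Real.sqrt_le_sqrt e1
  have hs₁ : 0 ≤ √(M₁ ^ 2 - a₁ ^ 2) := Real.sqrt_nonneg _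
  have f1 : 8 * π * M₀ * (θ * M₀) ≤ 8 * π * M₀ * √(M₀ ^ 2 - a₀ ^ 2) :=
    mul_le_mul_of_nonneg_left hs₀ (by positivity)
  have f2 : M₁ ^ 2 ≤ ((1 + θ / 16) * M₀) ^ 2 := sq_le_sq' (by linarith) hγ
  have g : (8 + 3 * θ) * (1 + θ / 16) ^ 2 ≤ 8 + 7 * θ := by nlinarith [hθ, hθ1, sq_nonneg θ]
  have f3 : (8 * π + 3 * π * θ) * M₁ ^ 2 ≤ (8 * π + 7 * π * θ) * M₀ ^ 2 := by
    have f2' : (8 * π + 3 * π * θ) * M₁ ^ 2 ≤ (8 * π + 3 * π * θ) * ((1 + θ / 16) * M₀) ^ 2 :=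
      mul_le_mul_of_nonneg_left f2 (by positivity)
    have g' : π * M₀ ^ 2 * ((8 + 3 * θ) * (1 + θ / 16) ^ 2) ≤ π * M₀ ^ 2 * (8 + 7 * θ) :=
      mul_le_mul_of_nonneg_left g (by positivity)
    nlinarith [f2', g']
  -- the later square root is at least `θ M₁ / 4`
  have key : 8 * π * M₁ * (θ * M₁ / 4) ≤ 8 * π * M₁ * √(M₁ ^ 2 - a₁ ^ 2) := by
    nlinarith [h, f1, f3, hs₁]
  have k2 : θ * M₁ / 4 ≤ √(M₁ ^ 2 - a₁ ^ 2) := le_of_mul_le_mul_left key (by positivity)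
  have k3 : 0 ≤ M₁ ^ 2 - a₁ ^ 2 := by
    have : a₁ ^ 2 ≤ M₁ ^ 2 := sq_le_sq' (abs_le.1 ha₁).1 (abs_le.1 ha₁).2
    linarith
  have k4 : (θ * M₁ / 4) * (θ * M₁ / 4) ≤ M₁ ^ 2 - a₁ ^ 2 := by
    have := mul_le_mul k2 k2 (by positivity) hs₁
    rwa [Real.mul_self_sqrt k3] at this
  have k5 : a₁ ^ 2 ≤ ((1 - θ ^ 2 / 32) * M₁) ^ 2 := by nlinarith [k4, hθ, hθ1, hM₁]
  have hc : 0 ≤ (1 - θ ^ 2 / 32) * M₁ := by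
    have : 0 ≤ 1 - θ ^ 2 / 32 := by nlinarith [hθ, hθ1]
    positivity
  calc |a₁| ≤ √(((1 - θ ^ 2 / 32) * M₁) ^ 2) := Real.abs_le_sqrt k5
    _ = (1 - θ ^ 2 / 32) * M₁ := Real.sqrt_sq hc

/-- **The lock in ratio form**: under the same hypotheses the later spin RATIO obeys
`|a₁| / M₁ ≤ 1 − θ²/32 < 1` — the uniform sub-extremality margin the collar-margin clause asks for,
with `χ₁ := 1 − θ²/32`. [folklore] -/
theorem GenericCensorshipCollarMargin.spin_ratio_lock_div {θ M₀ a₀ M₁ a₁ : ℝ} (hθ : 0 < θ) (hθ1 : θ ≤ 1)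
    (hM₀ : 0 < M₀) (hM₁ : 0 < M₁) (ha₀ : |a₀| ≤ (1 - θ) * M₀) (ha₁ : |a₁| ≤ M₁)
    (hγ : M₁ ≤ (1 + θ / 16) * M₀)
    (h : 8 * π * M₀ * Kerr.rPlus M₀ a₀ - π * θ * M₀ ^ 2 ≤
      8 * π * M₁ * Kerr.rPlus M₁ a₁ + π * θ * M₁ ^ 2) :
    |a₁| / M₁ ≤ 1 - θ ^ 2 / 32 ∧ 1 - θ ^ 2 / 32 < 1 := by
  refine ⟨?_, by nlinarith [hθ]⟩
  rw [div_le_iff₀ hM₁]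
  exact GenericCensorshipCollarMargin.spin_ratio_lock hθ hθ1 hM₀ hM₁ ha₀ ha₁ hγ h

/-- **Registered stub `spin_ratio_lock` of line `deficit-ratchet` (crux stmt-FinalStateConjecture-10809), verbatim
signature** — the Kerr-family spin-ratio lock in curried form, from
`GenericCensorshipCollarMargin.spin_ratio_lock`. [folklore] -/
theorem spin_ratio_lock : ∀ {θ M₀ a₀ M₁ a₁ : ℝ}, 0 < θ → θ ≤ 1 → 0 < M₀ → 0 < M₁ → |a₀| ≤ (1 - θ) * M₀ → |a₁| ≤ M₁ → M₁ ≤ (1 + θ / 16) * M₀ → 8 * Real.pi * M₀ * Literature.Geometry.Lorentzian.Kerr.rPlus M₀ a₀ - Real.pi * θ * M₀ ^ 2 ≤ 8 * Real.pi * M₁ * Literature.Geometry.Lorentzian.Kerr.rPlus M₁ a₁ + Real.pi * θ * M₁ ^ 2 → |a₁| ≤ (1 - θ ^ 2 / 32) * M₁ :=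
  fun hθ hθ1 hM₀ hM₁ ha₀ ha₁ hγ h =>
    GenericCensorshipCollarMargin.spin_ratio_lock hθ hθ1 hM₀ hM₁ ha₀ ha₁ hγ h

end Summit.FinalStateConjecture.FinalStateConjecture.Theorems

end
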